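import Literature.Analysis.FluidPDE.ConfinedHardSphereFlowGroup
import Literature.Analysis.FluidPDE.HardSphereFlowRestart
import HarnessLib

/-!
# Restarting the event-by-event confined hard-sphere flow: truncated regularity

Sixth layer of the proof of `ConfinedHardSphereFlow.nonempty_torus_balls` (existence of the
confined hard-sphere flow on the torus among fixed round scatterers; Cercignani–Illner–Pulvirenti
1994 Thm. 4.2.1, App. 4.A; iteration scheme of Gallagher–Saint-Raymond–Texier 2013, proof of
Prop. 4.1.1). Deterministic glue of the iteration over short windows, for the construction
`ConfinedAlexander.flow` of `ConfinedHardSphereFlowConstruction` — the line-by-line analogue of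
`Literature.Analysis.FluidPDE.HardSphereFlowRestart` (wall-free case):

* equivariance of the exit time along a free flight, `τ(S_s z) + s = τ(z)` for `0 ≤ s ≤ τ(z)`
  (`exitTime_freeFlight_add`), whence the event step and the exit configuration do not change
  along a free flight (`eventStep_freeFlight`);
* frozen dynamics after an infinite free flight, reachable states, states stay confined
  (`stateAfter_mem_of_mem`, round scatterers and regular geometry);
* `FwdGoodUpTo G W ε T z` — forward regularity up to time `T` (simple events at the instants
  `≤ T`, no touch of either kind inside the free flights before `T`, some instant beyond `T`),
  with `FwdGood ↔ ∀ n : ℕ, FwdGoodUpTo n`;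
* restart: states and instants of the dynamics restarted at `Φ_s z`, `Φ_{s+u} z = Φ_u (Φ_s z)` on
  matching segments, and additivity of truncated regularity (`FwdGoodUpTo.add`).

## References

* I. Gallagher, L. Saint-Raymond, B. Texier, *From Newton to Boltzmann* (2013), §4.1,
  Prop. 4.1.1 and its proof (p. 19).
* C. Cercignani, R. Illner, M. Pulvirenti, *The Mathematical Theory of Dilute Gases*, Springer
  (1994), §4.2 p. 65, App. 4.A p. 108.
-/

open Set Filter Function
open scoped Topology
open scoped ENNReal

namespace Literature.Analysis.FluidPDE

noncomputable section

section Kinetic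

variable {d : Type*} [Fintype d] {X : Type*} {N : ℕ} {ι : Type*}

namespace ConfinedAlexander

variable {G : Geometry d X} {W : ι → Wall d X} {ε : ℝ}

/-! ## The exit time along a free flight -/

/-- **Equivariance of the exit time under free flight**: `τ(S_s z) + s = τ(z)` for
`0 ≤ s ≤ τ(z)` (the free flight restarted at `S_s z` leaves the domain at the same absolute
time; CIP 1994 App. 4.A, the special-flow picture). [cite: CIP1994, App. 4.A p. 108] -/
theorem exitTime_freeFlight_add {z : Config N d X} {s : ℝ} (hs : 0 ≤ s)
    (h : ENNReal.ofReal s ≤ exitTime G W ε z) :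
    exitTime G W ε (freeFlight G s z) + ENNReal.ofReal s = exitTime G W ε z := by
  refine le_antisymm (le_sInf ?_) ?_
  · rintro b ⟨hb, hmem⟩
    have hsb : ENNReal.ofReal s ≤ b := h.trans (sInf_le ⟨hb, hmem⟩)
    have hsb' : s ≤ b.toReal := (ENNReal.ofReal_le_iff_le_toReal hb).1 hsb
    have h1 : exitTime G W ε (freeFlight G s z) ≤ ENNReal.ofReal (b.toReal - s) := by
      refine exitTime_le_of_not_mem (sub_nonneg.2 hsb') ?_
      rwa [← freeFlight_add, sub_add_cancel]
    calc exitTime G W ε (freeFlight G s z) + ENNReal.ofReal s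
        ≤ ENNReal.ofReal (b.toReal - s) + ENNReal.ofReal s := add_le_add h1 le_rfl
      _ = b := by
          rw [← ENNReal.ofReal_add (sub_nonneg.2 hsb') hs, sub_add_cancel, ENNReal.ofReal_toReal hb]
  · rw [← tsub_le_iff_right]
    refine le_sInf ?_
    rintro b ⟨hb, hmem⟩
    rw [tsub_le_iff_right]
    have h1 : exitTime G W ε z ≤ ENNReal.ofReal (b.toReal + s) := by
      refine exitTime_le_of_not_mem (add_nonneg ENNReal.toReal_nonneg hs) ?_
      rwa [freeFlight_add]
    calc exitTime G W ε z ≤ ENNReal.ofReal (b.toReal + s) := h1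
      _ = b + ENNReal.ofReal s := by
          rw [ENNReal.ofReal_add ENNReal.toReal_nonneg hs, ENNReal.ofReal_toReal hb]

/-- The exit time along a free flight, solved for `τ(S_s z)`: `τ(S_s z) = τ(z) - s` for
`0 ≤ s ≤ τ(z)`. [folklore] -/
theorem exitTime_freeFlight_eq_sub {z : Config N d X} {s : ℝ} (hs : 0 ≤ s)
    (h : ENNReal.ofReal s ≤ exitTime G W ε z) :
    exitTime G W ε (freeFlight G s z) = exitTime G W ε z - ENNReal.ofReal s := by
  rw [← exitTime_freeFlight_add hs h, ENNReal.add_sub_cancel_right ENNReal.ofReal_ne_top]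

/-- Along a free flight the exit configuration does not change: `S_{τ(S_s z)} (S_s z) = S_{τ(z)} z`
for `0 ≤ s ≤ τ(z) < ∞`. [folklore] -/
theorem freeFlight_exitTime_freeFlight {z : Config N d X} {s : ℝ} (hs : 0 ≤ s)
    (h : ENNReal.ofReal s ≤ exitTime G W ε z) (hτ : exitTime G W ε z ≠ ∞) :
    freeFlight G (exitTime G W ε (freeFlight G s z)).toReal (freeFlight G s z) =
      freeFlight G (exitTime G W ε z).toReal z := by
  rw [← freeFlight_add]
  congr 1
  have h1 := exitTime_freeFlight_add (G := G) (W := W) (ε := ε) hs h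
  have hτ' : exitTime G W ε (freeFlight G s z) ≠ ∞ := by
    intro htop; rw [htop, top_add] at h1; exact hτ h1.symm
  rw [← h1, ENNReal.toReal_add hτ' ENNReal.ofReal_ne_top, ENNReal.toReal_ofReal hs]

/-- Along a free flight the collision step does not change: `T (S_s z) = T z` for
`0 ≤ s ≤ τ(z) < ∞`. [folklore] -/
theorem eventStep_freeFlight {z : Config N d X} {s : ℝ} (hs : 0 ≤ s)
    (h : ENNReal.ofReal s ≤ exitTime G W ε z) (hτ : exitTime G W ε z ≠ ∞) :
    eventStep G W ε (freeFlight G s z) = eventStep G W ε z := by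
  have h1 := exitTime_freeFlight_add (G := G) (W := W) (ε := ε) hs h
  have hτ' : exitTime G W ε (freeFlight G s z) ≠ ∞ := by
    intro htop; rw [htop, top_add] at h1; exact hτ h1.symm
  rw [eventStep_of_ne_top hτ', eventStep_of_ne_top hτ, freeFlight_exitTime_freeFlight hs h hτ]

/-- If the free flight never leaves the domain, neither does the free flight restarted later:
`τ(z) = ∞ ⇒ τ(S_s z) = ∞` (`s ≥ 0`). [folklore] -/
theorem exitTime_freeFlight_eq_top {z : Config N d X} {s : ℝ} (hs : 0 ≤ s)
    (h : exitTime G W ε z = ∞) : exitTime G W ε (freeFlight G s z) = ∞ := by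
  have h1 := exitTime_freeFlight_add (G := G) (W := W) (ε := ε) hs (h ▸ le_top)
  rw [h, ENNReal.add_eq_top] at h1
  exact h1.resolve_right ENNReal.ofReal_ne_top

/-! ## States and instants: reachability, membership in the domain -/

/-- After a free flight that never ends, the dynamics is frozen: `τ(z_m) = ∞ ⇒ z_k = z_m` for
`k ≥ m`. [folklore] -/
theorem stateAfter_eq_of_exitTime_eq_top {z : Config N d X} {m : ℕ}
    (hm : exitTime G W ε (stateAfter G W ε z m) = ∞) {k : ℕ} (hmk : m ≤ k) :
    stateAfter G W ε z k = stateAfter G W ε z m := by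
  induction k with
  | zero => rw [Nat.le_zero.1 hmk]
  | succ k ih =>
    rcases Nat.of_le_succ hmk with hle | rfl
    · rw [stateAfter_succ, ih hle, eventStep_of_eq_top hm]
    · rfl

/-- A collision instant is finite iff all the earlier free flights are finite. [folklore] -/
theorem eventInstant_ne_top_iff {z : Config N d X} {k : ℕ} :
    eventInstant G W ε z k ≠ ∞ ↔ ∀ m < k, exitTime G W ε (stateAfter G W ε z m) ≠ ∞ := by
  rw [eventInstant, ENNReal.sum_ne_top]
  simp only [Finset.mem_range]

/-- Every state is a state reached at a finite instant: for each `k` there is `m ≤ k` with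
`t_m < ∞` and `z_k = z_m`. [folklore] -/
theorem exists_stateAfter_eq_reachable (z : Config N d X) (k : ℕ) :
    ∃ m ≤ k, eventInstant G W ε z m ≠ ∞ ∧ stateAfter G W ε z k = stateAfter G W ε z m := by
  classical
  let P : ℕ → Prop := fun m => exitTime G W ε (stateAfter G W ε z m) = ∞ ∨ m = k
  have hP : ∃ m, P m := ⟨k, Or.inr rfl⟩
  refine ⟨Nat.find hP, ?_, ?_, ?_⟩
  · exact Nat.find_min' hP (Or.inr rfl)
  · rw [eventInstant_ne_top_iff]
    intro m hm htop
    exact Nat.find_min hP hm (Or.inl htop)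
  · rcases (Nat.find_spec hP : P (Nat.find hP)) with htop | heq
    · exact stateAfter_eq_of_exitTime_eq_top htop (Nat.find_min' hP (Or.inr rfl))
    · rw [heq]

section Regular

variable [TopologicalSpace X] {ctr : ι → X} {ρ : ℝ} {hρ : 0 < ρ}

/-- The event step maps the confined domain to itself (round scatterers, geometry regular at
`ε` and `ρ`: the exit configuration is confined, and events do not move spheres). [folklore] -/
theorem eventStep_mem (hG : G.IsHardSphereRegular ε) (hGρ : G.IsHardSphereRegular ρ) {z : Config N d X}
    (hz : z ∈ confinedDomain G (Wall.balls G ctr ρ hρ) N ε) :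
    eventStep G (Wall.balls G ctr ρ hρ) ε z ∈ confinedDomain G (Wall.balls G ctr ρ hρ) N ε := by
  by_cases hτ : exitTime G (Wall.balls G ctr ρ hρ) ε z = ∞
  · rwa [eventStep_of_eq_top hτ]
  · rw [eventStep_of_ne_top hτ, eventJump_mem_confinedDomain_iff]
    exact freeFlight_exitTime_mem hG hGρ hz hτ

/-- All post-event states of a confined datum are confined (round scatterers, regular geometry;
no regularity of the orbit is needed). [folklore] -/
theorem stateAfter_mem_of_mem (hG : G.IsHardSphereRegular ε) (hGρ : G.IsHardSphereRegular ρ) {z : Config N d X}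
    (hz : z ∈ confinedDomain G (Wall.balls G ctr ρ hρ) N ε) (k : ℕ) :
    stateAfter G (Wall.balls G ctr ρ hρ) ε z k ∈ confinedDomain G (Wall.balls G ctr ρ hρ) N ε := by
  induction k with
  | zero => exact hz
  | succ k ih => rw [stateAfter_succ]; exact eventStep_mem hG hGρ ih

end Regular

/-! ## Truncated forward regularity -/

namespace FwdGoodUpTo

variable {T : ℝ} {z : Config N d X}

/-- Truncated regularity is monotone in the horizon. [folklore] -/
theorem mono (h : FwdGoodUpTo G W ε T z) {T' : ℝ} (hT : T' ≤ T) : FwdGoodUpTo G W ε T' z := by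
  have hle : ENNReal.ofReal T' ≤ ENNReal.ofReal T := ENNReal.ofReal_le_ofReal hT
  refine ⟨fun k hk => h.1 k (hk.trans hle), fun k t ht htk hkt => h.2.1 k t ht htk (hkt.trans hle),
    ?_⟩
  obtain ⟨k, hk⟩ := h.2.2
  exact ⟨k, hle.trans_lt hk⟩

/-- Up to the horizon every time lies in a collision segment: for `0 ≤ s ≤ T` there is `k` with
`t_k ≤ s < t_{k+1}`. [folklore] -/
theorem exists_segment (h : FwdGoodUpTo G W ε T z) {s : ℝ} (hs : s ≤ T) :
    ∃ k, eventInstant G W ε z k ≤ ENNReal.ofReal s ∧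
      ENNReal.ofReal s < eventInstant G W ε z (k + 1) := by
  classical
  obtain ⟨k0, hk0⟩ := h.2.2
  have hex : ∃ m, ENNReal.ofReal s < eventInstant G W ε z m :=
    ⟨k0, (ENNReal.ofReal_le_ofReal hs).trans_lt hk0⟩
  have hm0 : Nat.find hex ≠ 0 := by
    intro h0
    have := Nat.find_spec hex
    rw [h0, eventInstant_zero] at this
    exact ENNReal.not_lt_zero this
  obtain ⟨k, hk⟩ := Nat.exists_eq_add_one_of_ne_zero hm0
  refine ⟨k, ?_, by rw [← hk]; exact Nat.find_spec hex⟩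
  have := Nat.find_min hex (m := k) (by omega)
  exact not_lt.1 this

end FwdGoodUpTo

/-- **Forward regularity is truncated forward regularity at every integer horizon.** [folklore] -/
theorem fwdGood_iff_forall_fwdGoodUpTo {z : Config N d X} :
    FwdGood G W ε z ↔ ∀ n : ℕ, FwdGoodUpTo G W ε n z := by
  constructor
  · rintro ⟨h1, h2, h3⟩ n
    refine ⟨fun k hk => h1 k ?_, fun k t ht htk _ => h2 k t ht htk, ?_⟩
    · intro htop
      rw [eventInstant_succ, htop, add_top] at hk
      exact ENNReal.ofReal_ne_top (top_unique hk)
    · -- non-accumulation: the instants are unbounded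
      by_contra hno
      push Not at hno
      have hle : ∀ k, eventInstant G W ε z k ≤ ENNReal.ofReal n := hno
      have hsum : ∑' k, exitTime G W ε (stateAfter G W ε z k) ≤ ENNReal.ofReal n := by
        refine ENNReal.tsum_le_of_sum_range_le fun k => ?_
        exact hle k
      rw [h3] at hsum
      exact ENNReal.ofReal_ne_top (top_unique hsum)
  · intro h
    refine ⟨fun k hk => ?_, fun k t ht htk => ?_, ?_⟩
    · -- (i): the instant `t_{k+1}` is finite, pick an integer horizon beyond it
      have hfin : eventInstant G W ε z (k + 1) ≠ ∞ := by
        rw [eventInstant_ne_top_iff]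
        intro m hm htop
        have heq := stateAfter_eq_of_exitTime_eq_top htop (Nat.le_of_lt_succ hm)
        rw [heq] at hk
        exact hk htop
      obtain ⟨n, hn⟩ := exists_nat_ge (eventInstant G W ε z (k + 1)).toReal
      refine (h n).1 k ?_
      rw [← ENNReal.ofReal_toReal hfin]
      exact ENNReal.ofReal_le_ofReal hn
    · -- (ii): reduce to a reachable index
      obtain ⟨m, -, hm, heq⟩ := exists_stateAfter_eq_reachable (G := G) (W := W) (ε := ε) z k
      rw [heq] at htk ⊢
      have hfin : eventInstant G W ε z m + ENNReal.ofReal t ≠ ∞ :=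
        ENNReal.add_ne_top.2 ⟨hm, ENNReal.ofReal_ne_top⟩
      obtain ⟨n, hn⟩ := exists_nat_ge (eventInstant G W ε z m + ENNReal.ofReal t).toReal
      refine (h n).2.1 m t ht htk ?_
      rw [← ENNReal.ofReal_toReal hfin]
      exact ENNReal.ofReal_le_ofReal hn
    · -- (iii): the instants are unbounded, so the exit times are not summable
      by_contra hne
      have hlt : ∑' k, exitTime G W ε (stateAfter G W ε z k) < ∞ := lt_top_iff_ne_top.2 hne
      obtain ⟨n, hn⟩ := exists_nat_gt (∑' k, exitTime G W ε (stateAfter G W ε z k)).toReal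
      obtain ⟨k, hk⟩ := (h n).2.2
      have hle : eventInstant G W ε z k ≤ ∑' k, exitTime G W ε (stateAfter G W ε z k) :=
        ENNReal.sum_le_tsum _
      have : ENNReal.ofReal n < ∑' k, exitTime G W ε (stateAfter G W ε z k) := hk.trans_le hle
      rw [← ENNReal.ofReal_toReal hne, ENNReal.ofReal_lt_ofReal_iff_of_nonneg (Nat.cast_nonneg n)]
        at this
      exact lt_asymm this hn

/-! ## Restarting the dynamics from a point of the orbit -/

section Restart

variable {z : Config N d X} {s : ℝ} {k : ℕ}

/-- The data of a collision segment: `t_k ≤ s < t_{k+1}` gives `t_k < ∞`, `t_k ≤ s`,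
`0 ≤ s - t_k` and `s - t_k < τ(z_k)` hence `s - t_k ≤ τ(z_k)`. [folklore] -/
theorem segment_arith (hs : 0 ≤ s) (h1 : eventInstant G W ε z k ≤ ENNReal.ofReal s)
    (h2 : ENNReal.ofReal s < eventInstant G W ε z (k + 1)) :
    eventInstant G W ε z k ≠ ∞ ∧ (eventInstant G W ε z k).toReal ≤ s ∧
      ENNReal.ofReal (s - (eventInstant G W ε z k).toReal) <
        exitTime G W ε (stateAfter G W ε z k) ∧
      eventInstant G W ε z k + ENNReal.ofReal (s - (eventInstant G W ε z k).toReal) =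
        ENNReal.ofReal s := by
  have hfin : eventInstant G W ε z k ≠ ∞ := ne_top_of_le_ne_top ENNReal.ofReal_ne_top h1
  have hle : (eventInstant G W ε z k).toReal ≤ s := ENNReal.toReal_le_of_le_ofReal hs h1
  refine ⟨hfin, hle, ?_, ?_⟩
  · rw [eventInstant_succ] at h2
    exact Alexander.ofReal_sub_toReal_lt hs h1 h2
  · rw [← ENNReal.ofReal_toReal hfin, ENNReal.toReal_ofReal ENNReal.toReal_nonneg,
      ← ENNReal.ofReal_add ENNReal.toReal_nonneg (sub_nonneg.2 hle), add_sub_cancel]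

/-- **Restart, states**: if `t_k ≤ s < t_{k+1}` and `τ(z_k) < ∞`, the dynamics restarted at
`w = Φ_s z = S_{s - t_k} z_k` has post-collisional states `w_m = z_{k+m}` for `m ≥ 1`. [folklore] -/
theorem stateAfter_fwdFlow_succ (hs : 0 ≤ s) (h1 : eventInstant G W ε z k ≤ ENNReal.ofReal s)
    (h2 : ENNReal.ofReal s < eventInstant G W ε z (k + 1))
    (hτ : exitTime G W ε (stateAfter G W ε z k) ≠ ∞) (m : ℕ) :
    stateAfter G W ε (fwdFlow G W ε z s) (m + 1) = stateAfter G W ε z (k + (m + 1)) := by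
  obtain ⟨-, hle, hlt, -⟩ := segment_arith hs h1 h2
  rw [fwdFlow_eq_of_segment h1 h2]
  induction m with
  | zero =>
    rw [zero_add, ← stateAfter_stateAfter, stateAfter_one, stateAfter_one]
    exact eventStep_freeFlight (sub_nonneg.2 hle) hlt.le hτ
  | succ m ih =>
    rw [stateAfter_succ, ih, ← stateAfter_succ, Nat.add_assoc]

/-- **Restart, instants**: if `t_k ≤ s < t_{k+1}`, the collision instants of the restarted
dynamics are the later instants of the original one shifted by `s`: `t^w_m + s = t_{k+m}` for
`m ≥ 1`. [folklore] -/
theorem eventInstant_fwdFlow_succ_add (hs : 0 ≤ s)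
    (h1 : eventInstant G W ε z k ≤ ENNReal.ofReal s)
    (h2 : ENNReal.ofReal s < eventInstant G W ε z (k + 1)) (m : ℕ) :
    eventInstant G W ε (fwdFlow G W ε z s) (m + 1) + ENNReal.ofReal s =
      eventInstant G W ε z (k + (m + 1)) := by
  obtain ⟨hfin, hle, hlt, hsplit⟩ := segment_arith hs h1 h2
  have hw : fwdFlow G W ε z s =
      freeFlight G (s - (eventInstant G W ε z k).toReal) (stateAfter G W ε z k) :=
    fwdFlow_eq_of_segment h1 h2
  have hshift : exitTime G W ε (fwdFlow G W ε z s) +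
      ENNReal.ofReal (s - (eventInstant G W ε z k).toReal) =
        exitTime G W ε (stateAfter G W ε z k) := by
    rw [hw]; exact exitTime_freeFlight_add (sub_nonneg.2 hle) hlt.le
  induction m with
  | zero =>
    rw [zero_add, eventInstant_one, eventInstant_succ, ← hshift, ← hsplit]
    ring
  | succ m ih =>
    by_cases hτ : exitTime G W ε (stateAfter G W ε z k) = ∞
    · -- frozen dynamics: all later instants are infinite on both sides
      have hw' : exitTime G W ε (fwdFlow G W ε z s) = ∞ := by
        rw [hw]; exact exitTime_freeFlight_eq_top (sub_nonneg.2 hle) hτ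
      have hl : eventInstant G W ε (fwdFlow G W ε z s) (m + 1 + 1) = ∞ := by
        refine top_unique ?_
        calc (⊤ : ℝ≥0∞) = eventInstant G W ε (fwdFlow G W ε z s) 1 := by
              rw [eventInstant_one, hw']
          _ ≤ _ := monotone_eventInstant _ (by omega)
      have hr : eventInstant G W ε z (k + (m + 1 + 1)) = ∞ := by
        refine top_unique ?_
        calc (⊤ : ℝ≥0∞) = eventInstant G W ε z (k + 1) := by
              rw [eventInstant_succ, hτ, add_top]
          _ ≤ _ := monotone_eventInstant _ (by omega)
      rw [hl, hr, top_add]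
    · rw [eventInstant_succ, stateAfter_fwdFlow_succ hs h1 h2 hτ m, add_right_comm, ih,
        show k + (m + 1 + 1) = (k + (m + 1)) + 1 by omega, eventInstant_succ]

/-- **Restart, the flow**: `Φ_{s+u} z = Φ_u (Φ_s z)` for `s, u ≥ 0`, as soon as `s` lies in a
collision segment of `z` and `u` in one of `Φ_s z` (no regularity beyond that is needed).
[folklore] -/
theorem fwdFlow_add_of_segment (hs : 0 ≤ s) {u : ℝ} (hu : 0 ≤ u)
    (h1 : eventInstant G W ε z k ≤ ENNReal.ofReal s)
    (h2 : ENNReal.ofReal s < eventInstant G W ε z (k + 1)) {m : ℕ}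
    (h1' : eventInstant G W ε (fwdFlow G W ε z s) m ≤ ENNReal.ofReal u)
    (h2' : ENNReal.ofReal u < eventInstant G W ε (fwdFlow G W ε z s) (m + 1)) :
    fwdFlow G W ε z (s + u) = fwdFlow G W ε (fwdFlow G W ε z s) u := by
  obtain ⟨hfin, hle, hlt, hsplit⟩ := segment_arith hs h1 h2
  have hsu : ENNReal.ofReal (s + u) = ENNReal.ofReal u + ENNReal.ofReal s := by
    rw [add_comm, ENNReal.ofReal_add hu hs]
  rw [fwdFlow_eq_of_segment h1' h2']
  rcases Nat.eq_zero_or_pos m with rfl | hm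
  · -- still in the first free flight of the restarted dynamics
    have hA : eventInstant G W ε z k ≤ ENNReal.ofReal (s + u) :=
      h1.trans (ENNReal.ofReal_le_ofReal (by linarith))
    have hB : ENNReal.ofReal (s + u) < eventInstant G W ε z (k + 1) := by
      rw [hsu, ← eventInstant_fwdFlow_succ_add hs h1 h2 0]
      exact ENNReal.add_lt_add_right ENNReal.ofReal_ne_top h2'
    rw [fwdFlow_eq_of_segment hA hB, stateAfter_zero, eventInstant_zero, ENNReal.toReal_zero,
      sub_zero, fwdFlow_eq_of_segment h1 h2, ← freeFlight_add]
    congr 1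
    ring
  · obtain ⟨m, rfl⟩ := Nat.exists_eq_add_one_of_ne_zero hm.ne'
    have hinst := eventInstant_fwdFlow_succ_add hs h1 h2 m
    have hA : eventInstant G W ε z (k + (m + 1)) ≤ ENNReal.ofReal (s + u) := by
      rw [hsu, ← hinst]
      exact add_le_add h1' le_rfl
    have hB : ENNReal.ofReal (s + u) < eventInstant G W ε z (k + (m + 1) + 1) := by
      rw [hsu, show k + (m + 1) + 1 = k + (m + 1 + 1) by omega,
        ← eventInstant_fwdFlow_succ_add hs h1 h2 (m + 1)]
      exact ENNReal.add_lt_add_right ENNReal.ofReal_ne_top h2'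
    have hfin' : eventInstant G W ε (fwdFlow G W ε z s) (m + 1) ≠ ∞ :=
      ne_top_of_le_ne_top ENNReal.ofReal_ne_top h1'
    have hτ : exitTime G W ε (stateAfter G W ε z k) ≠ ∞ := by
      intro htop
      have : eventInstant G W ε z (k + (m + 1)) = ∞ := by
        refine top_unique ?_
        calc (⊤ : ℝ≥0∞) = eventInstant G W ε z (k + 1) := by
              rw [eventInstant_succ, htop, add_top]
          _ ≤ _ := monotone_eventInstant _ (by omega)
      rw [this] at hA
      exact ENNReal.ofReal_ne_top (top_unique hA)
    rw [fwdFlow_eq_of_segment hA hB, stateAfter_fwdFlow_succ hs h1 h2 hτ m]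
    congr 1
    have htR : (eventInstant G W ε z (k + (m + 1))).toReal =
        (eventInstant G W ε (fwdFlow G W ε z s) (m + 1)).toReal + s := by
      rw [← hinst, ENNReal.toReal_add hfin' ENNReal.ofReal_ne_top, ENNReal.toReal_ofReal hs]
    rw [htR]
    ring

/-- **Restart of truncated regularity**: if `z` is forward regular up to time `s` and `Φ_s z`
is forward regular up to time `u`, then `z` is forward regular up to time `s + u`, and
`Φ_{s+u} z = Φ_u (Φ_s z)` (the collision-by-collision dynamics restarted at a point of the
orbit reproduces the orbit; CIP 1994 §4.2, `T^t T^s = T^{t+s}`, here before knowing that the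
orbit is globally good). [cite: CIP1994, §4.2 p. 65] -/
theorem FwdGoodUpTo.add {u : ℝ} (hs : 0 ≤ s) (hu : 0 ≤ u) (hz : FwdGoodUpTo G W ε s z)
    (hw : FwdGoodUpTo G W ε u (fwdFlow G W ε z s)) :
    FwdGoodUpTo G W ε (s + u) z ∧ fwdFlow G W ε z (s + u) = fwdFlow G W ε (fwdFlow G W ε z s) u := by
  obtain ⟨k, h1, h2⟩ := hz.exists_segment le_rfl
  obtain ⟨hfin, hle, hlt, hsplit⟩ := segment_arith hs h1 h2
  have hweq : fwdFlow G W ε z s =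
      freeFlight G (s - (eventInstant G W ε z k).toReal) (stateAfter G W ε z k) :=
    fwdFlow_eq_of_segment h1 h2
  have hsu : ENNReal.ofReal (s + u) = ENNReal.ofReal u + ENNReal.ofReal s := by
    rw [add_comm, ENNReal.ofReal_add hu hs]
  have hshift : exitTime G W ε (fwdFlow G W ε z s) +
      ENNReal.ofReal (s - (eventInstant G W ε z k).toReal) =
        exitTime G W ε (stateAfter G W ε z k) := by
    rw [hweq]; exact exitTime_freeFlight_add (sub_nonneg.2 hle) hlt.le
  have hinst := eventInstant_fwdFlow_succ_add hs h1 h2   -- t^w_{m+1} + s = t_{k+m+1}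
  -- instants beyond `s` force `τ(z_k) < ∞`
  have hτ_of_le : ∀ {m : ℕ} {c : ℝ≥0∞}, c ≠ ∞ → eventInstant G W ε z (k + (m + 1)) ≤ c →
      exitTime G W ε (stateAfter G W ε z k) ≠ ∞ := by
    intro m c hc hmc htop
    have : eventInstant G W ε z (k + (m + 1)) = ∞ := by
      refine top_unique ?_
      calc (⊤ : ℝ≥0∞) = eventInstant G W ε z (k + 1) := by
            rw [eventInstant_succ, htop, add_top]
        _ ≤ _ := monotone_eventInstant _ (by omega)
    rw [this] at hmc
    exact hc (top_unique hmc)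
  -- an index `k'` whose segment reaches beyond `s` is `≥ k`
  have hk_le : ∀ {k' : ℕ}, ENNReal.ofReal s < eventInstant G W ε z (k' + 1) → k ≤ k' := by
    intro k' hk'
    by_contra hlt'
    have : eventInstant G W ε z (k' + 1) ≤ eventInstant G W ε z k :=
      monotone_eventInstant _ (by omega)
    exact (not_le.2 hk') (this.trans h1)
  refine ⟨⟨fun k' hk' => ?_, fun k' t ht htk hkt => ?_, ?_⟩,
    (hw.exists_segment le_rfl).elim fun m hm => fwdFlow_add_of_segment hs hu h1 h2 hm.1 hm.2⟩
  · -- (i) simple incoming exits up to time `s + u`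
    by_cases hcase : eventInstant G W ε z (k' + 1) ≤ ENNReal.ofReal s
    · exact hz.1 k' hcase
    obtain ⟨m, rfl⟩ := Nat.exists_eq_add_of_le (hk_le (not_le.1 hcase))
    rw [Nat.add_assoc] at hk'
    have hτ : exitTime G W ε (stateAfter G W ε z k) ≠ ∞ :=
      hτ_of_le ENNReal.ofReal_ne_top hk'
    have hwm : eventInstant G W ε (fwdFlow G W ε z s) (m + 1) ≤ ENNReal.ofReal u := by
      rw [hsu, ← hinst m] at hk'
      exact (ENNReal.add_le_add_iff_right ENNReal.ofReal_ne_top).1 hk'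
    have key := hw.1 m hwm
    rcases Nat.eq_zero_or_pos m with rfl | hmpos
    · -- the current free flight of `z_k`, seen from `Φ_s z`
      rw [stateAfter_zero, hweq, freeFlight_exitTime_freeFlight (sub_nonneg.2 hle) hlt.le hτ]
        at key
      simpa only [add_zero] using key
    · obtain ⟨m, rfl⟩ := Nat.exists_eq_add_one_of_ne_zero hmpos.ne'
      rwa [stateAfter_fwdFlow_succ hs h1 h2 hτ m] at key
  · -- (ii) no touch inside the free flights up to time `s + u`
    by_cases hcase : eventInstant G W ε z k' + ENNReal.ofReal t ≤ ENNReal.ofReal s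
    · exact hz.2.1 k' t ht htk hcase
    have hfin' : eventInstant G W ε z k' ≠ ∞ := by
      intro htop; rw [htop, top_add] at hkt; exact ENNReal.ofReal_ne_top (top_unique hkt)
    have hk' : k ≤ k' := by
      refine hk_le (lt_of_lt_of_le (not_le.1 hcase) ?_)
      rw [eventInstant_succ]
      exact add_le_add le_rfl htk.le
    obtain ⟨m, rfl⟩ := Nat.exists_eq_add_of_le hk'
    rcases Nat.eq_zero_or_pos m with rfl | hmpos
    · -- inside the current free flight of `z_k`: time `t - (s - t_k)` after `Φ_s z`
      simp only [add_zero] at htk hkt hcase ⊢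
      have hta : s - (eventInstant G W ε z k).toReal < t := by
        by_contra hle'
        push Not at hle'
        apply hcase
        calc eventInstant G W ε z k + ENNReal.ofReal t
            ≤ eventInstant G W ε z k +
                ENNReal.ofReal (s - (eventInstant G W ε z k).toReal) := by
              gcongr
          _ = ENNReal.ofReal s := hsplit
      have heq : freeFlight G t (stateAfter G W ε z k) =
          freeFlight G (t - (s - (eventInstant G W ε z k).toReal)) (fwdFlow G W ε z s) := by
        rw [hweq, ← freeFlight_add, sub_add_cancel]
      rw [heq]
      refine hw.2.1 0 (t - (s - (eventInstant G W ε z k).toReal)) (sub_pos.2 hta) ?_ ?_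
      · rw [stateAfter_zero]
        have : ENNReal.ofReal t = ENNReal.ofReal (t - (s - (eventInstant G W ε z k).toReal)) +
            ENNReal.ofReal (s - (eventInstant G W ε z k).toReal) := by
          rw [← ENNReal.ofReal_add (sub_pos.2 hta).le (sub_nonneg.2 hle), sub_add_cancel]
        rw [← hshift, this] at htk
        exact (ENNReal.add_lt_add_iff_right ENNReal.ofReal_ne_top).1 htk
      · rw [eventInstant_zero, zero_add]
        refine ENNReal.ofReal_le_ofReal ?_
        have h3 : (eventInstant G W ε z k).toReal + t ≤ s + u := by
          have := hkt
          rw [← ENNReal.ofReal_toReal hfin, ← ENNReal.ofReal_add ENNReal.toReal_nonneg ht.le]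
            at this
          exact (ENNReal.ofReal_le_ofReal_iff (by linarith)).1 this
        linarith
    · obtain ⟨m, rfl⟩ := Nat.exists_eq_add_one_of_ne_zero hmpos.ne'
      have hτ : exitTime G W ε (stateAfter G W ε z k) ≠ ∞ :=
        hτ_of_le (c := ENNReal.ofReal (s + u)) ENNReal.ofReal_ne_top
          ((le_add_right le_rfl).trans hkt)
      rw [← stateAfter_fwdFlow_succ hs h1 h2 hτ m] at htk ⊢
      refine hw.2.1 (m + 1) t ht htk ?_
      rw [hsu, ← hinst m, add_right_comm] at hkt
      exact (ENNReal.add_le_add_iff_right ENNReal.ofReal_ne_top).1 hkt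
  · -- (iii) an instant beyond `s + u`
    obtain ⟨m, hm⟩ := hw.2.2
    have hm0 : m ≠ 0 := by
      rintro rfl
      rw [eventInstant_zero] at hm
      exact ENNReal.not_lt_zero hm
    obtain ⟨m, rfl⟩ := Nat.exists_eq_add_one_of_ne_zero hm0
    refine ⟨k + (m + 1), ?_⟩
    rw [hsu, ← hinst m]
    exact ENNReal.add_lt_add_right ENNReal.ofReal_ne_top hm

end Restart

/-- The forward flow stays in the domain up to the horizon of truncated regularity (in fact on
every collision segment, by definition of the exit time). [folklore] -/
theorem FwdGoodUpTo.fwdFlow_mem {T : ℝ} {z : Config N d X} (h : FwdGoodUpTo G W ε T z) {s : ℝ}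
    (hs0 : 0 ≤ s) (hs : s ≤ T) : fwdFlow G W ε z s ∈ confinedDomain G W N ε := by
  obtain ⟨k, h1, h2⟩ := h.exists_segment hs
  obtain ⟨-, hle, hlt, -⟩ := segment_arith hs0 h1 h2
  rw [fwdFlow_eq_of_segment h1 h2]
  exact freeFlight_mem_confinedDomain_of_lt (sub_nonneg.2 hle) hlt

end ConfinedAlexander

end Kinetic

end

end Literature.Analysis.FluidPDE
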